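/-
Copyright: public-domain mathematics; typed transcription for the H21 Literature library (cell lit-balaban,
reader/typer seat r02 gen 9 = literature-prover-lit-balaban-r02-g9-0; fold owner of block B2).

statement-level skeleton of published theorems with citation tags; proofs where landed; nothing here is a claim about the Yang–Mills mass gap

# Bałaban, *(Higgs)₂,₃ quantum fields in a finite volume. II. An upper bound*, Commun. Math. Phys. **86** (1982) 555–594
# — (3.11) p. 585 «G″_k ≧ γ₁m²(Lᵏε)²I↾_{Λ₅⁽ᵏ⁾}» BY THE PRINTED MECHANISM «it suffices to use the mass terms in the
# fundamental operators», FOR THE LOCALIZED fluctuation operators `Δ^{(k)}_{Λ}(Ω, Ã)` of (2.27)/(2.46)/(3.9) — the typer's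
# concrete `B2Eq227CondDelta.condDelta227` built on the conditioned covariance `C^{(k−1)}_Λ` of part I (2.32)
# (`HiggsCondCov232.condCov232`) — at every level, for every coupling, region, external field and conditioning set

[cite: Balaban1982Higgs2]  T. Bałaban, Commun. Math. Phys. 86 (1982) 555–594.  p. 585 [PDF 31], verbatim (render
`run/shared/lean/pub/pub-balaban/b2b-balaban-ref1/pages/1982-cmp86-higgs23-II/1982-cmp86-higgs23-II-p031-x2.png` re-read):
*"We need the estimates of the quadratic forms in (3.9). Let us denote the quadratic forms in A_k, φ_k, connected with the
first four terms in the exponential under the integral (3.9), by ⟨A_k, G′_kA_k⟩, ⟨φ_k, G″_kφ_k⟩ correspondingly. We will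
give the estimates from below for these forms. It is sufficient to get very weak estimates because we have the strong
estimates (3.8), (3.10). To get them it suffices to use the mass terms in the fundamental operators −Δ^η + μ₀²(Lᵏε)² and
−Δ^{η,N}_{Ã^{(k)},B^k(Λ₂^{(k−1)′})} + m²(Lᵏε)². In the next section of this chapter we will formulate a much stronger estimate,
which as a corollary gives  G′_k ≧ γ₁μ₀²(Lᵏε)²I↾_{Λ₅⁽ᵏ⁾},  G″_k ≧ γ₁m²(Lᵏε)²I↾_{Λ₅⁽ᵏ⁾}. (3.11)"*  The third and fourth
terms of (3.9) are `−½⟨Λ₅⁽ᵏ⁾A_k, Δ^{(k)}_{Λ₅^{(k−1)}}Λ₅⁽ᵏ⁾A_k⟩ − ½⟨Λ₅⁽ᵏ⁾φ_k, Δ^{(k)}_{Λ₅^{(k−1)}}(B^k(Λ₂^{(k−1)′}), Ã^{(k)})Λ₅⁽ᵏ⁾φ_k⟩`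
(display (3.9) re-read on the render: the operators carry the LOCALIZATION subscript `Λ₅^{(k−1)}` of (2.46) p. 567), i.e.
forms of the operators of (2.27) p. 562: *"⟨ψ, Δ^{(k+1),L}_Λ(Ω, A)ψ⟩ = aL^{d−2} Σ_{y∈Λ′} |ψ(y)|² − a²L^{−4}⟨ψ,
Q(A)C^{(k)}_Λ(Ω, A)Q^*(A)ψ⟩, Λ ⊂ Ω^{(k)}, (2.27)"*, with part I [Balaban1982Higgs1] (2.32) p. 611: *"C^{(k)}_Λ(Ω, A) =
((aL^{−2}P(A) + Δ^{(k)}(Ω, A))↾_Λ)^{−1}"*.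

WHAT THIS MODULE ADDS (SKELETON rows **B2.Eq3.11** ((3.11)–(3.12)) and **B2.Eq3.1-3.10** (member (3.9)); owner's cells).
Companions BY NAME, nothing restated: the typer's `B2Eq227CondDelta.{condDelta227, stepCoef, siteInner_condDelta227}`
((2.27) at every level on the concrete carrier), `HiggsCondCov232.{condCov232, restrictOp_precOpA_condCov232_apply,
condCov232_apply_of_not_mem, siteInner_cutTo, restrictOp_apply}` ((I.2.32)), p35's `B1Eq230FluctCov.{precOpA, blockProjA,
deltaKA}` and `B1Eq27StepAdjoint.{avgQLin, avgQAdjLin, avgQLin_avgQAdjLin, siteInner_avgQAdjLin}`, r02 g7's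
`B2Ineq311DeltaKConcrete.siteInner_deltaKA_succ_ge` (the same mechanism for the UNlocalized `Δ^{(k)}`), r14's
`B2Ineq311MassTerm.gamma1_uniform`.
* `cDelta` — the mass constant of `Δ^{(j),Lʲε}(Ω,A)` at every level (`m²` at `j = 0` by (I.2.17) `−Δ^N ≥ 0`; r02 g7's
  `a_j(Lʲε)^{−2}m²/(a_j(Lʲε)^{−2} + m²)` at `j ≥ 1`), `siteInner_deltaKA_ge`, and the QUANTITATIVE coercivity of the operator
  inverted in (I.2.30)/(I.2.32), `siteInner_precOpA_ge`.
* `siteInner_avgQLin_self_le` — one-step Jensen `‖Q(A)φ‖ ≤ ‖φ‖` (from `QQ^* = 1`).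
* **`siteInner_condDelta227_ge`** — for `m² > 0`, `a > 0`, `L > 1`, `k + 1 ≤ K`, EVERY `C`, `Ω`, `Ã`, `Λ′ ⊂ T^{(k+1)}` and every
  `ψ` supported on `Λ′`:  `[βc/(β + c)]·⟨ψ,ψ⟩ ≤ ⟨ψ, Δ^{(k+1)}_{Λ}(Ω,Ã)ψ⟩`, `β = a(L^{k+1}ε)^{−2}`, `c = cDelta k` — the printed
  mechanism run through the conditioned covariance: with `φ := C^{(k)}_Λ Q^*ψ` (supported in `Λ = B(Λ′)`),
  `X := ⟨Q^*ψ, φ⟩ = ⟨φ, (βP + Δ^{(k)})φ⟩ = β‖Qφ‖² + ⟨φ, Δ^{(k)}φ⟩ ≥ (β + c)‖Qφ‖²` and `X = ⟨ψ, Qφ⟩ ≤ ‖ψ‖‖Qφ‖`, so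
  `(β + c)X ≤ ‖ψ‖²` and `⟨ψ, Δ_Λψ⟩ = β‖ψ‖² − β²X ≥ βc/(β + c)·‖ψ‖²`; and **`siteInner_condDelta227_ge_uniform`**: ONE
  constant `a·c_∞/(a + c_∞)`, `c_∞ = [a(1 − L⁻²)/(a(1 − L⁻²) + m²)]·m²`, for all levels with `L^{k+1}ε ≤ 1`, all volumes,
  all `Λ′`, `Ω`, `Ã` (the printed «γ₁ … I↾» reading; in unit-lattice letters `γ₁m²(Lᵏε)²`).

HONEST SCOPE.  Kernel inequalities on the concrete carrier for the typer's (2.27) operators; the vector species («the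
similar formula holds for the vector field», (2.27); `μ₀²` for `m²`) is the specialisation `C = zeroCharge`, `A = 0`, `Ω = T`,
`N = d` (`B1Eq230FluctCov.deltaKA_zero_field`, `B2Eq227CondDelta.condDelta227_zero_field`) and is covered by the same
theorems.  The assembly of `G′_k`, `G″_k` of (3.9) from these blocks and the averaging squares is the companion file of this
seat (`B2Eq39QuadraticForms`).  Nothing about the densities (2.46)/(3.9) as integrals is proved.  value = the (3.11)
mechanism for the operators that actually occur in (3.9) — NOT summit progress.
-/
import Mathlib
import Literature.MathematicalPhysics.QuantumFieldTheory.Balaban1983to89.B2Ineq311DeltaKConcrete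
import Literature.MathematicalPhysics.QuantumFieldTheory.Balaban1983to89.B2Eq227CondDelta

open scoped BigOperators InnerProductSpace

namespace Literature.MathematicalPhysics.QuantumFieldTheory.Balaban1983to89.B2Ineq311CondDelta

open Literature.MathematicalPhysics.QuantumFieldTheory.Balaban1983to89
open HiggsLattice HiggsAveraging HiggsCovariance HiggsCovariancePos HiggsCovarianceCont HiggsFluctMeasure HiggsFluctMeasurePos
  HiggsFluctMeasureCov B1Eq27StepAdjoint B1Eq230FluctCov B1Eq230FluctCovPos B2Ineq311DeltaKConcrete HiggsCondCov232
  B2Eq255Concrete B2Eq227CondDelta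

noncomputable section

variable {P : HiggsLattice.Params} {N : ℕ}

/-! ## §1 The mass constants of `Δ^{(j)}(Ω, A)` and the coercivity of `a(L^{j+1}ε)^{−2}P(A) + Δ^{(j)}(Ω, A)` -/

/-- The mass-term constant of `Δ^{(j),Lʲε}(Ω,A)`: `m²` at `j = 0` ((I.2.17): `−Δ^{ε,N}_{A,Ω} + m² ≥ m²`), and r02 g7's
`a_j(Lʲε)^{−2}m²/(a_j(Lʲε)^{−2} + m²)` at `j ≥ 1` (`B2Ineq311DeltaKConcrete.siteInner_deltaKA_succ_ge`).
[cite: Balaban1982Higgs2, (3.11) p.585] -/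
def cDelta (P : HiggsLattice.Params) (msq a : ℝ) : ℕ → ℝ
  | 0 => msq
  | j + 1 => coeff221 P a (j + 1) * msq / (coeff221 P a (j + 1) + msq)

/-- `cDelta j > 0` for `m² > 0`, `a > 0`, `L > 1`. [cite: Balaban1982Higgs2, (3.11) p.585] -/
theorem cDelta_pos {msq a : ℝ} (hmsq : 0 < msq) (ha : 0 < a) (hL : 1 < (P.L : ℝ)) :
    ∀ j : ℕ, 0 < cDelta P msq a j
  | 0 => hmsq
  | j + 1 => by
      have hc : 0 < coeff221 P a (j + 1) := coeff221_pos ha hL (Nat.succ_le_succ (Nat.zero_le j))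
      unfold cDelta
      positivity

/-- With `Lʲε ≤ 1` the mass constant is bounded below UNIFORMLY in the level: `c_∞ := [a(1 − L⁻²)/(a(1 − L⁻²) + m²)]·m² ≤ cDelta j`
(r14's `gamma1_uniform` at `j ≥ 1`; at `j = 0`, `c_∞ ≤ m²`). [cite: Balaban1982Higgs2, (3.11) p.585] [cite: Balaban1982Higgs1, (2.15) p.609] -/
theorem cinf_le_cDelta {msq a : ℝ} (hmsq : 0 < msq) (ha : 0 < a) (hL : 1 < (P.L : ℝ)) {j : ℕ} (hεj : P.mesh j ≤ 1) :
    a * (1 - ((P.L : ℝ) ^ 2)⁻¹) / (a * (1 - ((P.L : ℝ) ^ 2)⁻¹) + msq) * msq ≤ cDelta P msq a j := by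
  have hainf : 0 < a * (1 - ((P.L : ℝ) ^ 2)⁻¹) := by
    have hL2 : 1 < (P.L : ℝ) ^ 2 := by nlinarith
    have : ((P.L : ℝ) ^ 2)⁻¹ < 1 := inv_lt_one_of_one_lt₀ hL2
    exact mul_pos ha (by linarith)
  cases j with
  | zero =>
      show _ ≤ msq
      have h1 : a * (1 - ((P.L : ℝ) ^ 2)⁻¹) / (a * (1 - ((P.L : ℝ) ^ 2)⁻¹) + msq) ≤ 1 := by
        rw [div_le_one (by positivity)]; linarith
      calc a * (1 - ((P.L : ℝ) ^ 2)⁻¹) / (a * (1 - ((P.L : ℝ) ^ 2)⁻¹) + msq) * msq ≤ 1 * msq :=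
            mul_le_mul_of_nonneg_right h1 hmsq.le
        _ = msq := one_mul _
  | succ j =>
      show _ ≤ coeff221 P a (j + 1) * msq / (coeff221 P a (j + 1) + msq)
      rw [gamma1_eq]
      have hγ := B2Ineq311MassTerm.gamma1_uniform (k := j + 1) (ℓ := P.mesh (j + 1)) ha hL
        (Nat.succ_le_succ (Nat.zero_le j)) hmsq (P.mesh_pos (j + 1)) hεj
      exact mul_le_mul_of_nonneg_right hγ hmsq.le

section Ops

variable (C : ChargeData N) (Ω : Finset (HiggsLattice.Site P 0)) (A : HiggsLattice.VecField P 0)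

/-- **The mass term of `Δ^{(j),Lʲε}(Ω, A)` at every level `j ≤ K`**: `cDelta j · ⟨φ,φ⟩ ≤ ⟨φ, Δ^{(j)}(Ω,A)φ⟩` (`j = 0`:
`−Δ^N ≥ 0`, `HiggsCovariancePos.siteInner_covLaplacianN_nonneg`; `j ≥ 1`: r02 g7). [cite: Balaban1982Higgs2, (3.11) p.585] [cite: Balaban1982Higgs1, (2.17) p.610] -/
theorem siteInner_deltaKA_ge {msq a : ℝ} (hmsq : 0 < msq) (ha : 0 < a) (hL : 1 < (P.L : ℝ)) :
    ∀ {j : ℕ}, j ≤ P.K → ∀ φ : ScalarField P j N,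
      cDelta P msq a j * siteInner φ φ ≤ siteInner φ (deltaKA C Ω A msq a j φ)
  | 0, _, φ => by
      show msq * siteInner φ φ ≤ siteInner φ (delta0 C Ω A msq φ)
      unfold delta0
      rw [LinearMap.add_apply, LinearMap.smul_apply, LinearMap.id_apply, siteInner_add_right, siteInner_smul_right]
      have h := siteInner_covLaplacianN_nonneg C Ω A φ
      linarith
  | j + 1, hj, φ => siteInner_deltaKA_succ_ge C Ω A hmsq ha hL hj φ

/-- **Quantitative coercivity of the operator inverted in (I.2.30)/(I.2.32)**:
`cDelta j · ⟨φ,φ⟩ ≤ ⟨φ, (a(L^{j+1}ε)^{−2}P(A) + Δ^{(j)}(Ω,A))φ⟩` (`P(A) ≥ 0` dropped, mass term kept; the typer's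
`siteInner_precOpA_pos` is the qualitative `> 0`). [cite: Balaban1982Higgs1, (2.32) p.611] [cite: Balaban1982Higgs2, (3.11) p.585] -/
theorem siteInner_precOpA_ge {msq a : ℝ} (hmsq : 0 < msq) (ha : 0 < a) (hL : 1 < (P.L : ℝ)) {j : ℕ} (hj : j ≤ P.K)
    (φ : ScalarField P j N) :
    cDelta P msq a j * siteInner φ φ ≤ siteInner φ (precOpA C Ω A msq a j φ) := by
  rw [precOpA_eq, LinearMap.add_apply, LinearMap.smul_apply, siteInner_add_right, siteInner_smul_right]
  have h1 := siteInner_deltaKA_ge C Ω A hmsq ha hL hj φ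
  have h2 : 0 ≤ stepCoef P a j * siteInner φ (blockProjA C A j φ) :=
    mul_nonneg (stepCoef_pos ha j).le (siteInner_blockProjA_nonneg C A j φ)
  linarith

/-- One-step Jensen: `⟨Q(A)φ, Q(A)φ⟩ ≤ ⟨φ,φ⟩` for `j < K` (`Q^*` is an isometry since `QQ^* = 1`, so `‖Q‖ ≤ 1`).
[cite: Balaban1982Higgs1, (2.7) p.608] -/
theorem siteInner_avgQLin_self_le {j : ℕ} (hj : j < P.K) (φ : ScalarField P j N) :
    siteInner (avgQLin C A j φ) (avgQLin C A j φ) ≤ siteInner φ φ := by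
  set v := avgQLin C A j φ with hv
  -- `‖Q^*v‖² = ⟨v, QQ^*v⟩ = ‖v‖²`
  have hiso : siteInner (avgQAdjLin C A j v) (avgQAdjLin C A j v) = siteInner v v := by
    rw [siteInner_avgQAdjLin, avgQLin_avgQAdjLin hj]
  -- `‖v‖² = ⟨Q^*v, φ⟩ ≤ ‖Q^*v‖‖φ‖`
  have h1 : siteInner v v = siteInner (avgQAdjLin C A j v) φ := by
    rw [siteInner_avgQAdjLin]
  have hcs : siteInner (avgQAdjLin C A j v) φ ≤ sNorm (avgQAdjLin C A j v) * sNorm φ := siteInner_le_sNorm_mul _ _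
  have hvv : 0 ≤ siteInner v v := siteInner_self_nonneg v
  have hφφ : 0 ≤ siteInner φ φ := siteInner_self_nonneg φ
  have hsq : siteInner v v ^ 2 ≤ siteInner v v * siteInner φ φ := by
    have hn1 := sNorm_nonneg (avgQAdjLin C A j v)
    have hn2 := sNorm_nonneg φ
    calc siteInner v v ^ 2 = (siteInner (avgQAdjLin C A j v) φ) ^ 2 := by rw [h1]
      _ ≤ (sNorm (avgQAdjLin C A j v) * sNorm φ) ^ 2 := by
          have h0 : 0 ≤ siteInner (avgQAdjLin C A j v) φ := by rw [← h1]; exact hvv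
          gcongr
      _ = siteInner v v * siteInner φ φ := by rw [mul_pow, sNorm_sq, sNorm_sq, hiso]
  rcases hvv.lt_or_eq with hpos | hzero
  · exact le_of_mul_le_mul_left (by nlinarith [hsq]) hpos
  · rw [← hzero]; exact hφφ

/-! ## §2 (3.11) for the localized operators of (2.27)/(2.46)/(3.9) -/

/-- `C^{(k)}_Λ(Ω,A)g` is supported in `Λ`: `Λ(C^{(k)}_Λ g) = C^{(k)}_Λ g`. [cite: Balaban1982Higgs1, (2.32) p.611] -/
theorem cutTo_condCov232 (msq a : ℝ) (k : ℕ) (Λ : Finset (HiggsLattice.Site P k)) (g : ScalarField P k N) :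
    cutTo Λ (condCov232 C Ω A msq a k Λ g) = condCov232 C Ω A msq a k Λ g := by
  funext x
  by_cases hx : x ∈ Λ
  · exact cutTo_of_mem Λ _ hx
  · rw [cutTo_of_not_mem Λ _ hx, condCov232_apply_of_not_mem C Ω A msq a k Λ g hx]

/-- **(3.11) for the LOCALIZED fluctuation operator, explicit constant**: for `m² > 0`, `a > 0`, `L > 1`, `k + 1 ≤ K`, EVERY
coupling `C`, region `Ω`, external field `Ã`, conditioning set `Λ′ ⊂ T^{(k+1)}` (`Λ = B(Λ′)`), and EVERY `ψ` on `T^{(k+1)}`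
supported on `Λ′`:  `[βc/(β + c)]·⟨ψ,ψ⟩ ≤ ⟨ψ, Δ^{(k+1),L^{k+1}ε}_Λ(Ω,Ã)ψ⟩` with `β = a(L^{k+1}ε)^{−2}` (`stepCoef`) and
`c = cDelta k` — «it suffices to use the mass terms in the fundamental operators» through the conditioned covariance
(I.2.32): `φ := C^{(k)}_ΛQ^*ψ`, `X := ⟨Q^*ψ, φ⟩ = ⟨φ, (βP + Δ^{(k)})φ⟩ ≥ (β + c)‖Qφ‖²`, `X = ⟨ψ, Qφ⟩ ≤ ‖ψ‖‖Qφ‖`, hence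
`(β + c)X ≤ ‖ψ‖²` and, by (2.27), `⟨ψ, Δ_Λψ⟩ = β‖ψ‖² − β²X ≥ βc/(β + c)·‖ψ‖²`.
[cite: Balaban1982Higgs2, (3.11) p.585] [cite: Balaban1982Higgs2, (2.27) p.562] -/
theorem siteInner_condDelta227_ge {msq a : ℝ} (hmsq : 0 < msq) (ha : 0 < a) (hL : 1 < (P.L : ℝ)) {k : ℕ}
    (hk : k + 1 ≤ P.K) (Λ' : Finset (HiggsLattice.Site P (k + 1))) (ψ : ScalarField P (k + 1) N)
    (hψ : cutTo Λ' ψ = ψ) :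
    stepCoef P a k * cDelta P msq a k / (stepCoef P a k + cDelta P msq a k) * siteInner ψ ψ
      ≤ siteInner ψ (condDelta227 C Ω A msq a k Λ' ψ) := by
  have hkK : k ≤ P.K := by omega
  have hklt : k < P.K := by omega
  have hβ : 0 < stepCoef P a k := stepCoef_pos ha k
  have hc : 0 < cDelta P msq a k := cDelta_pos hmsq ha hL k
  set β : ℝ := stepCoef P a k with hβ_def
  set c : ℝ := cDelta P msq a k with hc_def
  set Λ : Finset (HiggsLattice.Site P k) := blockSet Λ' with hΛ_def
  set g : ScalarField P k N := avgQAdjLin C A k ψ with hg_def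
  set φ : ScalarField P k N := condCov232 C Ω A msq a k Λ g with hφ_def
  -- `φ` is supported in `Λ` and `(βP + Δ^{(k)})↾_Λ φ = Λ Q^*ψ`
  have hφΛ : cutTo Λ φ = φ := cutTo_condCov232 C Ω A msq a k Λ g
  have hsolve : restrictOp Λ (precOpA C Ω A msq a k) φ = cutTo Λ g :=
    restrictOp_precOpA_condCov232_apply C Ω A hmsq ha hL hkK Λ g
  set X : ℝ := siteInner g φ with hX_def
  set s2 : ℝ := siteInner ψ ψ with hs2_def
  set u2 : ℝ := siteInner (avgQLin C A k φ) (avgQLin C A k φ) with hu2_def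
  have hs2 : 0 ≤ s2 := siteInner_self_nonneg ψ
  have hu2 : 0 ≤ u2 := siteInner_self_nonneg _
  -- `X = ⟨φ, (βP + Δ^{(k)})φ⟩`
  have hXM : X = siteInner φ (precOpA C Ω A msq a k φ) := by
    have h1 : siteInner (cutTo Λ g) φ = siteInner g φ := by
      rw [siteInner_comm, siteInner_cutTo_comm, hφΛ]
    rw [hX_def, ← h1, ← hsolve, restrictOp_apply, hφΛ, siteInner_comm, siteInner_cutTo_comm, hφΛ, siteInner_comm]
  -- `X ≥ β‖Qφ‖² + c‖φ‖² ≥ (β + c)‖Qφ‖²`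
  have hXge : (β + c) * u2 ≤ X := by
    rw [hXM, precOpA_eq, LinearMap.add_apply, LinearMap.smul_apply, siteInner_add_right, siteInner_smul_right,
      siteInner_blockProjA_eq, ← hβ_def, ← hu2_def]
    have h1 := siteInner_deltaKA_ge C Ω A hmsq ha hL hkK φ
    rw [← hc_def] at h1
    have hJ : u2 ≤ siteInner φ φ := siteInner_avgQLin_self_le C A hklt φ
    nlinarith
  -- `X = ⟨ψ, Qφ⟩ ≤ ‖ψ‖‖Qφ‖`, so `X² ≤ s2·u2`
  have hadj : X = siteInner ψ (avgQLin C A k φ) := by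
    rw [hX_def, hg_def, siteInner_avgQAdjLin]
  have hXsq : X ^ 2 ≤ s2 * u2 := by
    rw [hadj]
    have h1 : siteInner ψ (avgQLin C A k φ) ≤ sNorm ψ * sNorm (avgQLin C A k φ) := siteInner_le_sNorm_mul _ _
    have h2 : siteInner (avgQLin C A k φ) ψ ≤ sNorm (avgQLin C A k φ) * sNorm ψ := siteInner_le_sNorm_mul _ _
    rw [siteInner_comm] at h2
    have hprod : 0 ≤ sNorm ψ * sNorm (avgQLin C A k φ) := mul_nonneg (sNorm_nonneg _) (sNorm_nonneg _)
    have habs : |siteInner ψ (avgQLin C A k φ)| ≤ sNorm ψ * sNorm (avgQLin C A k φ) := by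
      rw [abs_le]; constructor <;> nlinarith
    calc siteInner ψ (avgQLin C A k φ) ^ 2
        = |siteInner ψ (avgQLin C A k φ)| ^ 2 := (sq_abs _).symm
      _ ≤ (sNorm ψ * sNorm (avgQLin C A k φ)) ^ 2 := by gcongr
      _ = s2 * u2 := by rw [mul_pow, sNorm_sq, sNorm_sq]
  -- hence `(β + c)·X ≤ s2`
  have hX0 : 0 ≤ X := le_trans (mul_nonneg (by positivity) hu2) hXge
  have hkey : (β + c) * X ≤ s2 := by
    rcases hX0.lt_or_eq with hXpos | hX0'
    · have h1 : (β + c) * X ^ 2 ≤ s2 * X := by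
        calc (β + c) * X ^ 2 ≤ (β + c) * (s2 * u2) := mul_le_mul_of_nonneg_left hXsq (by positivity)
          _ = s2 * ((β + c) * u2) := by ring
          _ ≤ s2 * X := mul_le_mul_of_nonneg_left hXge hs2
      by_contra hnot
      push Not at hnot
      have : s2 * X < (β + c) * X * X := mul_lt_mul_of_pos_right hnot hXpos
      nlinarith
    · rw [← hX0']; simpa using hs2
  -- (2.27): `⟨ψ, Δ_Λψ⟩ = β·s2 − β²·X` (`ψ` supported on `Λ′`)
  have hform : siteInner ψ (condDelta227 C Ω A msq a k Λ' ψ) = β * s2 - β ^ 2 * X := by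
    rw [siteInner_condDelta227, hψ]
  rw [hform]
  have hβc : 0 < β + c := by positivity
  rw [div_mul_eq_mul_div, div_le_iff₀ hβc]
  nlinarith [mul_pos hβ hβ, hkey, hX0]

/-- Monotonicity of `(t, s) ↦ ts/(t + s)` in both arguments (on the positive quadrant). [cite: Balaban1982Higgs2, (3.11) p.585] -/
theorem frac_mono {t t' s s' : ℝ} (ht : 0 < t) (htt : t ≤ t') (hs : 0 < s) (hss : s ≤ s') :
    t * s / (t + s) ≤ t' * s' / (t' + s') := by
  rw [div_le_div_iff₀ (by linarith) (by linarith)]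
  nlinarith [mul_le_mul_of_nonneg_left hss ht.le, mul_le_mul_of_nonneg_right htt hs.le,
    mul_le_mul htt hss hs.le (by linarith), mul_pos ht hs]

/-- `β = a(L^{k+1}ε)^{−2} ≥ a` when `L^{k+1}ε ≤ 1`. [cite: Balaban1982Higgs2, (2.27) p.562] -/
theorem le_stepCoef {a : ℝ} (ha : 0 ≤ a) {k : ℕ} (hε : P.mesh (k + 1) ≤ 1) : a ≤ stepCoef P a k := by
  rw [stepCoef_eq]
  have hm : 0 < P.mesh (k + 1) := P.mesh_pos (k + 1)
  have h1 : 1 ≤ (P.mesh (k + 1))⁻¹ := one_le_inv_iff₀.mpr ⟨hm, hε⟩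
  have h2 : 1 ≤ (P.mesh (k + 1))⁻¹ ^ 2 := by nlinarith
  nlinarith

/-- **(3.11) for the localized operators with ONE γ₁ for all levels and volumes**: with `L^{k+1}ε ≤ 1`,
`[a·c_∞/(a + c_∞)]·⟨ψ,ψ⟩ ≤ ⟨ψ, Δ^{(k+1)}_Λ(Ω,Ã)ψ⟩` for every `ψ` supported on `Λ′`, `c_∞ = [a(1 − L⁻²)/(a(1 − L⁻²) + m²)]·m²`
— the constant depends on `d`-free data `a, L, m²` only: independent of `k`, of the torus, of `Λ′`, `Ω`, `Ã`, `C` (the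
printed «γ₁m²(Lᵏε)²I↾» in unit-lattice letters). [cite: Balaban1982Higgs2, (3.11) p.585] [cite: Balaban1982Higgs1, (2.15) p.609] -/
theorem siteInner_condDelta227_ge_uniform {msq a : ℝ} (hmsq : 0 < msq) (ha : 0 < a) (hL : 1 < (P.L : ℝ)) {k : ℕ}
    (hk : k + 1 ≤ P.K) (hε : P.mesh (k + 1) ≤ 1) (Λ' : Finset (HiggsLattice.Site P (k + 1)))
    (ψ : ScalarField P (k + 1) N) (hψ : cutTo Λ' ψ = ψ) :
    let cinf : ℝ := a * (1 - ((P.L : ℝ) ^ 2)⁻¹) / (a * (1 - ((P.L : ℝ) ^ 2)⁻¹) + msq) * msq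
    a * cinf / (a + cinf) * siteInner ψ ψ ≤ siteInner ψ (condDelta227 C Ω A msq a k Λ' ψ) := by
  intro cinf
  -- `Lᵏε ≤ Lᵏ⁺¹ε ≤ 1`
  have hεk : P.mesh k ≤ 1 := by
    refine le_trans ?_ hε
    unfold HiggsLattice.Params.mesh
    have hL1 : (1 : ℝ) ≤ (P.L : ℝ) := hL.le
    exact mul_le_mul_of_nonneg_right (pow_le_pow_right₀ hL1 (Nat.le_succ k)) P.hε.le
  have h := siteInner_condDelta227_ge C Ω A hmsq ha hL hk Λ' ψ hψ
  have hs2 : 0 ≤ siteInner ψ ψ := siteInner_self_nonneg ψ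
  have hainf : 0 < a * (1 - ((P.L : ℝ) ^ 2)⁻¹) := by
    have hL2 : 1 < (P.L : ℝ) ^ 2 := by nlinarith
    have : ((P.L : ℝ) ^ 2)⁻¹ < 1 := inv_lt_one_of_one_lt₀ hL2
    exact mul_pos ha (by linarith)
  have hcinf : 0 < cinf := by positivity
  have hcle : cinf ≤ cDelta P msq a k := cinf_le_cDelta hmsq ha hL hεk
  have hmono : a * cinf / (a + cinf) ≤ stepCoef P a k * cDelta P msq a k / (stepCoef P a k + cDelta P msq a k) :=
    frac_mono ha (le_stepCoef ha.le hε) hcinf hcle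
  exact le_trans (mul_le_mul_of_nonneg_right hmono hs2) h

end Ops

end

end Literature.MathematicalPhysics.QuantumFieldTheory.Balaban1983to89.B2Ineq311CondDelta
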